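import Summits.RiemannHypothesis.RiemannHypothesis.Theorems.Splittings.JensenSignLawCount
import Summits.RiemannHypothesis.RiemannHypothesis.Theorems.Splittings.JensenLaguerreFactorial
import HarnessLib

/-!
# THE BIRTH BAND OF THE JENSEN SIGN LAW — cell `rh-split`, desk rh-split-jen-neg g15 (ADDENDUM 16, rider R1)

HONEST LABEL: «SPLITTING SEARCH over kernel-typed RH-EQUIVALENCES; a splitting A ∧ B ⟹ RH is CONDITIONAL
bookkeeping unless A and B are both proved; nothing here bears on the truth of RH.»

RH-FREE real-polynomial analysis (class level; no statement mentions ξ or RH). Port of §§5–8 of HOME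
`rh-split-jen-neg/g15/SigmaBand.lean`, on top of the landed σ file `Splittings/JensenSignLawCount.lean` (`SignLaw`,
`signLaw_iff_nonrealRootCount_eq`, `exists_root_of_odd_natDegree`) and the L4 port `Splittings/JensenLaguerreFactorial.lean`
(`dataOf`, `nonrealRootCount_jensenPoly_dataOf_le`):

* §5 PARITY: `N(p) = natDegree p − #real roots` is even (`even_nonrealRootCount'`);
* §6 σ on the Jensen grid under the sharp guard `0 < natDegree J^{d+1,n}`: `SignLaw (J^{d+1,n}) ↔ N(J^{d+1,n}) = N(J^{d,n+1})`;
* §7 BAND THEOREM (one-pair rows, every real `γ`): `B_n` fails at degree `d+1` iff row `n` is non-hyperbolic at `d+1` and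
  row `n+1` is hyperbolic at `d` (`not_signLaw_iff_notSplits_and_splits`); in birth language exactly on `δ(n) ≤ d+1 ≤ δ(n+1)`
  (`not_signLaw_iff_mem_band`); births descend at most one degree per row (`birth_le_birth_succ_add_one`); and
  **`B_n` holds at every degree iff the births are Rolle-saturated, `δ(n) = δ(n+1) + 1`** (`signLaw_forall_iff_saturated`);
* §8 the same for polynomial one-pair data `γ_k = k!·P_k`, `N(P) ≤ 2`, positive coefficients (`band_dataOf`,
  `blind_iff_saturated_dataOf`).
-/

open Polynomial Set Filter Topology

set_option linter.dupNamespace false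

namespace Summit.RiemannHypothesis.RiemannHypothesis.Theorems.Splittings.JensenBirthBand

open Summit.RiemannHypothesis.RiemannHypothesis.Theorems.Splittings.JensenSignLawCount

/-! ## §5 PARITY — a real polynomial has an EVEN number of non-real zeros (`N(p)` is even) -/

section Parity

open Literature.Analysis.Complex

/-- Dividing out a real root does not change `N`: if `p = (X - C x) * q` with `q ≠ 0` then `N(p) = N(q)`. -/
theorem nonrealRootCount_X_sub_C_mul (x : ℝ) {q : ℝ[X]} (hq : q ≠ 0) :
    nonrealRootCount ((X - C x) * q) = nonrealRootCount q := by
  unfold nonrealRootCount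
  rw [natDegree_mul (X_sub_C_ne_zero x) hq, natDegree_X_sub_C, roots_mul (mul_ne_zero (X_sub_C_ne_zero x) hq),
    roots_X_sub_C]
  simp
  omega

/-- **Parity (proved):** `N(p) = natDegree p − #real roots` is EVEN for every real polynomial `p`.
Proof: strip real roots one at a time (`N` unchanged); a real polynomial without real roots has even degree, since an
odd-degree one has a real root (`exists_root_of_odd_natDegree`). -/
theorem even_nonrealRootCount : ∀ (k : ℕ) (p : ℝ[X]), Multiset.card p.roots = k → Even (nonrealRootCount p)
  | 0, p, h => by
      have hroots : p.roots = 0 := Multiset.card_eq_zero.1 h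
      unfold nonrealRootCount
      rw [h, Nat.sub_zero]
      rcases Nat.even_or_odd p.natDegree with he | ho
      · exact he
      · exfalso
        have hp0 : p ≠ 0 := by
          rintro rfl
          simp at ho
        obtain ⟨x, hx⟩ := exists_root_of_odd_natDegree ho
        have hmem : x ∈ p.roots := (mem_roots hp0).2 hx
        rw [hroots] at hmem
        simp at hmem
  | k + 1, p, h => by
      have hp0 : p ≠ 0 := by
        rintro rfl
        simp at h
      obtain ⟨x, hx⟩ : ∃ x, x ∈ p.roots := Multiset.card_pos_iff_exists_mem.1 (by omega)
      have hroot : IsRoot p x := (mem_roots hp0).1 hx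
      obtain ⟨q, hq⟩ : (X - C x) ∣ p := dvd_iff_isRoot.2 hroot
      have hq0 : q ≠ 0 := by
        rintro rfl
        simp at hq
        exact hp0 hq
      have hcard : Multiset.card q.roots = k := by
        have : Multiset.card p.roots = Multiset.card q.roots + 1 := by
          rw [hq, roots_mul (mul_ne_zero (X_sub_C_ne_zero x) hq0), roots_X_sub_C]
          simp
        omega
      rw [hq, nonrealRootCount_X_sub_C_mul x hq0]
      exact even_nonrealRootCount k q hcard

/-- Every real polynomial has an even number of non-real roots (counted with multiplicity). -/
theorem even_nonrealRootCount' (p : ℝ[X]) : Even (nonrealRootCount p) :=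
  even_nonrealRootCount _ p rfl

end Parity

/-! ## §6 σ ON THE GRID UNDER THE SHARP GUARD `0 < natDegree J^{d+1,n}` (covers polynomial data, whose top
coefficients vanish) -/

section Grid

open Literature.NumberTheory.LFunctions
open Literature.Analysis.Complex
open Summit.RiemannHypothesis.RiemannHypothesis.Theorems.Splittings

/-- σ in `N`-form on the grid, sharp guard: whenever `J^{d+1,n}_γ` has positive degree,
`SignLaw (J^{d+1,n}_γ) ↔ N(J^{d+1,n}_γ) = N(J^{d,n+1}_γ)` (no non-vanishing of `γ` assumed). -/
theorem signLaw_jensenPoly_iff_count {γ : ℕ → ℝ} {n d : ℕ} (hdeg : 0 < (jensenPoly γ (d + 1) n).natDegree) :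
    SignLaw (jensenPoly γ (d + 1) n) ↔
      nonrealRootCount (jensenPoly γ (d + 1) n) = nonrealRootCount (jensenPoly γ d (n + 1)) := by
  rw [signLaw_iff_nonrealRootCount_eq _ hdeg, JensenLaguerreFlow.derivative_jensenPoly_succ,
    JensenCountMonotonicity.nonrealRootCount_C_mul (by exact_mod_cast Nat.succ_ne_zero d)]

/-- … and its negation: the sign law fails iff a non-real pair is BORN on the step `(d, n+1) → (d+1, n)`. -/
theorem not_signLaw_jensenPoly_iff_count_lt {γ : ℕ → ℝ} {n d : ℕ} (hdeg : 0 < (jensenPoly γ (d + 1) n).natDegree) :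
    ¬ SignLaw (jensenPoly γ (d + 1) n) ↔
      nonrealRootCount (jensenPoly γ d (n + 1)) < nonrealRootCount (jensenPoly γ (d + 1) n) := by
  rw [signLaw_jensenPoly_iff_count hdeg]
  have := JensenCountMonotonicity.nonrealRootCount_jensenPoly_shift_le γ d n
  omega

/-- The sign law HOLDS at every degree where the row is hyperbolic (no hypothesis on the row above): a hyperbolic
`J^{d+1,n}` of positive degree has `N = 0 ≥ N(J^{d,n+1})`. -/
theorem signLaw_jensenPoly_of_splits {γ : ℕ → ℝ} {n d : ℕ} (hdeg : 0 < (jensenPoly γ (d + 1) n).natDegree)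
    (hs : (jensenPoly γ (d + 1) n).Splits) : SignLaw (jensenPoly γ (d + 1) n) := by
  rw [signLaw_jensenPoly_iff_count hdeg]
  have h0 : nonrealRootCount (jensenPoly γ (d + 1) n) = 0 := (nonrealRootCount_eq_zero_iff _).2 hs
  have := JensenCountMonotonicity.nonrealRootCount_jensenPoly_shift_le γ d n
  omega

end Grid

/-! ## §7 THE BAND THEOREM FOR ONE-PAIR ROWS (class level, every real `γ`) -/

section Band

open Literature.NumberTheory.LFunctions
open Literature.Analysis.Complex
open Summit.RiemannHypothesis.RiemannHypothesis.Theorems.Splittings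

/-- **BAND THEOREM, cell form (proved).** If `J^{d+1,n}_γ` has positive degree and carries AT MOST ONE non-real pair
(`N ≤ 2`), then the sign law `B_n` FAILS at degree `d+1` iff row `n` is (already) non-hyperbolic at degree `d+1` AND
row `n+1` is (still) hyperbolic at degree `d`. Ingredients: σ (§6), parity (§5), T2 of the tree. -/
theorem not_signLaw_iff_notSplits_and_splits {γ : ℕ → ℝ} {n d : ℕ}
    (hdeg : 0 < (jensenPoly γ (d + 1) n).natDegree) (h2 : nonrealRootCount (jensenPoly γ (d + 1) n) ≤ 2) :
    ¬ SignLaw (jensenPoly γ (d + 1) n) ↔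
      (¬ (jensenPoly γ (d + 1) n).Splits ∧ (jensenPoly γ d (n + 1)).Splits) := by
  rw [not_signLaw_jensenPoly_iff_count_lt hdeg, ← nonrealRootCount_eq_zero_iff, ← nonrealRootCount_eq_zero_iff]
  obtain ⟨a, ha⟩ := even_nonrealRootCount' (jensenPoly γ (d + 1) n)
  obtain ⟨b, hb⟩ := even_nonrealRootCount' (jensenPoly γ d (n + 1))
  have hT2 := JensenCountMonotonicity.nonrealRootCount_jensenPoly_shift_le γ d n
  constructor
  · intro hlt
    constructor <;> omega
  · rintro ⟨h0, h1⟩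
    omega

/-- **BAND THEOREM, birth form (proved).** One-pair row `n` born at `δ₀` (hyperbolic exactly below `δ₀`), row `n+1`
born at `δ₁`: the sign law `B_n` fails EXACTLY at the degrees `d+1` with `δ₀ ≤ d+1 ≤ δ₁` — the BAND between the two
birth degrees (R5 (S3) corollary of the card, there PENCIL). -/
theorem not_signLaw_iff_mem_band {γ : ℕ → ℝ} {n δ₀ δ₁ : ℕ}
    (hdeg : ∀ d, 0 < (jensenPoly γ (d + 1) n).natDegree) (h2 : ∀ d, nonrealRootCount (jensenPoly γ (d + 1) n) ≤ 2)
    (hδ₀ : ∀ d, (jensenPoly γ d n).Splits ↔ d < δ₀) (hδ₁ : ∀ d, (jensenPoly γ d (n + 1)).Splits ↔ d < δ₁) (d : ℕ) :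
    ¬ SignLaw (jensenPoly γ (d + 1) n) ↔ δ₀ ≤ d + 1 ∧ d + 1 ≤ δ₁ := by
  rw [not_signLaw_iff_notSplits_and_splits (hdeg d) (h2 d), hδ₀, hδ₁]
  omega

/-- Tail form: row `n+1` hyperbolic at every degree ⇒ `B_n` fails exactly from the birth of row `n` on. -/
theorem not_signLaw_iff_ge_birth_of_splits_above {γ : ℕ → ℝ} {n δ₀ : ℕ}
    (hdeg : ∀ d, 0 < (jensenPoly γ (d + 1) n).natDegree) (h2 : ∀ d, nonrealRootCount (jensenPoly γ (d + 1) n) ≤ 2)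
    (hδ₀ : ∀ d, (jensenPoly γ d n).Splits ↔ d < δ₀) (hA : ∀ d, (jensenPoly γ d (n + 1)).Splits) (d : ℕ) :
    ¬ SignLaw (jensenPoly γ (d + 1) n) ↔ δ₀ ≤ d + 1 := by
  rw [not_signLaw_iff_notSplits_and_splits (hdeg d) (h2 d), hδ₀]
  simp only [hA d, and_true]
  omega

/-- Never-born form: row `n` hyperbolic at every degree ⇒ `B_n` holds at every degree (no parity / one-pair needed). -/
theorem signLaw_of_row_splits {γ : ℕ → ℝ} {n : ℕ}
    (hdeg : ∀ d, 0 < (jensenPoly γ (d + 1) n).natDegree) (hA : ∀ d, (jensenPoly γ d n).Splits) (d : ℕ) :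
    SignLaw (jensenPoly γ (d + 1) n) :=
  signLaw_jensenPoly_of_splits (hdeg d) (hA (d + 1))

/-- (S2) of the card, class level (proved): births propagate DOWN the rows at most one degree per row —
if row `n+1` is non-hyperbolic at degree `d` then row `n` is non-hyperbolic at degree `d+1` (T2). In birth language
`δ(n) ≤ δ(n+1) + 1`. -/
theorem birth_le_birth_succ_add_one {γ : ℕ → ℝ} {n δ₀ δ₁ : ℕ}
    (hδ₀ : ∀ d, (jensenPoly γ d n).Splits ↔ d < δ₀) (hδ₁ : ∀ d, (jensenPoly γ d (n + 1)).Splits ↔ d < δ₁) :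
    δ₀ ≤ δ₁ + 1 := by
  have h1 : ¬ (jensenPoly γ δ₁ (n + 1)).Splits := by rw [hδ₁]; omega
  have h0 : ¬ (jensenPoly γ (δ₁ + 1) n).Splits := by
    rw [← nonrealRootCount_eq_zero_iff] at h1 ⊢
    have := JensenCountMonotonicity.nonrealRootCount_jensenPoly_shift_le γ δ₁ n
    omega
  rw [hδ₀] at h0
  omega

/-- A degree-`0` row polynomial is a constant, hence hyperbolic: every birth degree is positive. -/
theorem birth_pos {γ : ℕ → ℝ} {n δ : ℕ} (hδ : ∀ d, (jensenPoly γ d n).Splits ↔ d < δ) : 0 < δ := by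
  have h : (jensenPoly γ 0 n).Splits :=
    Splits.of_natDegree_le_one ((natDegree_jensenPoly_le γ 0 n).trans (by omega))
  exact (hδ 0).1 h

/-- **BLINDNESS ⟺ ROLLE-SATURATION (proved).** For a one-pair row `n` born at `δ₀` with row `n+1` born at `δ₁`:
the sign law `B_n` holds at EVERY degree (B is blind to the pair forever) iff the two births are at CONSECUTIVE
degrees, row `n+1` first: `δ₀ = δ₁ + 1` — the mechanism of every blind member on the card (B17, ADD.13–15), now an
iff in kernel; g3's corner theorem is the ξ-instance `n = 0` of the direction ⇒. -/
theorem signLaw_forall_iff_saturated {γ : ℕ → ℝ} {n δ₀ δ₁ : ℕ}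
    (hdeg : ∀ d, 0 < (jensenPoly γ (d + 1) n).natDegree) (h2 : ∀ d, nonrealRootCount (jensenPoly γ (d + 1) n) ≤ 2)
    (hδ₀ : ∀ d, (jensenPoly γ d n).Splits ↔ d < δ₀) (hδ₁ : ∀ d, (jensenPoly γ d (n + 1)).Splits ↔ d < δ₁) :
    (∀ d, SignLaw (jensenPoly γ (d + 1) n)) ↔ δ₀ = δ₁ + 1 := by
  have hle := birth_le_birth_succ_add_one hδ₀ hδ₁
  have hpos := birth_pos hδ₁
  constructor
  · intro h
    have key := h (δ₁ - 1)
    rw [← not_not (a := SignLaw _), not_signLaw_iff_mem_band hdeg h2 hδ₀ hδ₁] at key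
    omega
  · intro heq d
    rw [← not_not (a := SignLaw _), not_signLaw_iff_mem_band hdeg h2 hδ₀ hδ₁]
    omega

end Band

/-! ## §8 POLYNOMIAL ONE-PAIR DATA `γ_k = k!·P_k` (the card's model class; tree `JensenLaguerreFactorial.dataOf`) -/

section PolyData

open Literature.NumberTheory.LFunctions
open Literature.Analysis.Complex
open Summit.RiemannHypothesis.RiemannHypothesis.Theorems.Splittings
open Summit.RiemannHypothesis.RiemannHypothesis.Theorems.Splittings.JensenLaguerreFactorial (dataOf)

/-- `N(P⁽ⁿ⁾) ≤ N(P)` (iterate Rolle in count form). -/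
theorem nonrealRootCount_iterate_derivative_le (P : ℝ[X]) (n : ℕ) :
    nonrealRootCount (derivative^[n] P) ≤ nonrealRootCount P := by
  induction n with
  | zero => simp
  | succ n ih =>
    rw [Function.iterate_succ_apply']
    exact (JensenCountMonotonicity.nonrealRootCount_derivative_le _).trans ih

/-- Every cell of the Jensen array of polynomial data carries at most `N(P)` non-real zeros (tree: Laguerre for the
factorial multiplier, `nonrealRootCount_jensenPoly_dataOf_le`, then Rolle). -/
theorem nonrealRootCount_jensenPoly_dataOf_le_top (P : ℝ[X]) (d n : ℕ) :
    nonrealRootCount (jensenPoly (dataOf P) d n) ≤ nonrealRootCount P :=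
  (JensenLaguerreFactorial.nonrealRootCount_jensenPoly_dataOf_le P d n).trans
    (nonrealRootCount_iterate_derivative_le P n)

/-- Rows `n < deg P` of positive-coefficient polynomial data have positive degree from `d = 1` on. -/
theorem natDegree_jensenPoly_dataOf_pos (P : ℝ[X]) (hpos : ∀ k ≤ P.natDegree, 0 < P.coeff k) {n : ℕ}
    (hn : n < P.natDegree) (d : ℕ) : 0 < (jensenPoly (dataOf P) (d + 1) n).natDegree := by
  refine Nat.pos_of_ne_zero fun h0 => ?_
  have h1 : (jensenPoly (dataOf P) (d + 1) n).coeff 1 = 0 :=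
    coeff_eq_zero_of_natDegree_lt (by rw [h0]; exact Nat.one_pos)
  rw [JensenCountMonotonicity.coeff_jensenPoly'] at h1
  unfold dataOf at h1
  have hc : 0 < P.coeff (n + 1) := hpos (n + 1) (by omega)
  have hch : (0 : ℝ) < ((d + 1).choose 1 : ℕ) := by exact_mod_cast Nat.choose_pos (by omega)
  have hf : (0 : ℝ) < ((n + 1).factorial : ℕ) := by exact_mod_cast Nat.factorial_pos _
  exact (mul_pos hch (mul_pos hf hc)).ne' h1

/-- **BAND THEOREM for polynomial one-pair data (proved).** `P` with positive coefficients and at most one non-real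
pair (`N(P) ≤ 2`), data `γ_k = k!·P_k`, any row `n < deg P`: the sign law `B_n` fails at degree `d+1` iff row `n` is
non-hyperbolic at `d+1` and row `n+1` is hyperbolic at `d`. With the tree's `splits_iff_lt_birth` this is the interval
`[δ(n), δ(n+1)]` of §7 (`not_signLaw_iff_mem_band`), the tail (`not_signLaw_iff_ge_birth_of_splits_above`) or `∅`. -/
theorem band_dataOf (P : ℝ[X]) (hpos : ∀ k ≤ P.natDegree, 0 < P.coeff k) (hN : nonrealRootCount P ≤ 2)
    {n : ℕ} (hn : n < P.natDegree) (d : ℕ) :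
    ¬ SignLaw (jensenPoly (dataOf P) (d + 1) n) ↔
      (¬ (jensenPoly (dataOf P) (d + 1) n).Splits ∧ (jensenPoly (dataOf P) d (n + 1)).Splits) :=
  not_signLaw_iff_notSplits_and_splits (natDegree_jensenPoly_dataOf_pos P hpos hn d)
    ((nonrealRootCount_jensenPoly_dataOf_le_top P (d + 1) n).trans hN)

/-- … and BLINDNESS ⟺ ROLLE-SATURATION for polynomial one-pair data: if rows `n` and `n+1` are born at `δ₀`, `δ₁`
then `B_n` holds at every degree iff `δ₀ = δ₁ + 1`. -/
theorem blind_iff_saturated_dataOf (P : ℝ[X]) (hpos : ∀ k ≤ P.natDegree, 0 < P.coeff k)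
    (hN : nonrealRootCount P ≤ 2) {n δ₀ δ₁ : ℕ} (hn : n < P.natDegree)
    (hδ₀ : ∀ d, (jensenPoly (dataOf P) d n).Splits ↔ d < δ₀)
    (hδ₁ : ∀ d, (jensenPoly (dataOf P) d (n + 1)).Splits ↔ d < δ₁) :
    (∀ d, SignLaw (jensenPoly (dataOf P) (d + 1) n)) ↔ δ₀ = δ₁ + 1 :=
  signLaw_forall_iff_saturated (natDegree_jensenPoly_dataOf_pos P hpos hn)
    (fun d => (nonrealRootCount_jensenPoly_dataOf_le_top P (d + 1) n).trans hN) hδ₀ hδ₁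

end PolyData

end Summit.RiemannHypothesis.RiemannHypothesis.Theorems.Splittings.JensenBirthBand
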